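import Literature.MathematicalPhysics.QuantumFieldTheory.BalabanImbrieJaffe1984to88.BIJ88PolyInteraction308

/-!
# `BalabanImbrieJaffe1984to88.BIJ88PolyInteractionBounds308` — T. Bałaban, J. Imbrie, A. Jaffe, *Effective action and cluster
properties of the abelian Higgs model*, Commun. Math. Phys. **114** (1988) 257–315 [BalabanImbrieJaffe1988]: Sect. 5.14, p. 309
[PDF 53], verbatim (v1.1: re-read as an IMAGE, `lit-balaban-ref-1/renders/cmp114/original-p053-x2.png`): *"This is obtained in the Gaussian
integration estimate, using the fact that V^{(k)}(Y) is a small polynomial in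
A^{(k)}, φ^{(k)}. [The restrictions disappear as t → 0, so V^{(k)}(Y) cannot be replaced by its supremum.] The factors e^{−tV^{(k)}(Y)} − 1
can be bounded as before, because the coefficient t in front of V^{(k)}(Y) plus a small power of e_k easily beat the bounds A^{(k)},
φ^{(k)} ≦ cp(e_k)."* — the ESTIMATES behind this bracketed remark for a POLYNOMIALLY BOUNDED interaction `|W| ≤ K(1 + Σ_{b∈Λ}|Φ_b|)^m`
(sequel of `BIJ88PolyInteraction308`; used by `BIJ88PolyInteractionLimits308` for the `t → 0⁺` limits).

statement-level skeleton of published theorems with citation tags; proofs where landed; nothing here is a claim about the Yang–Mills mass gap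

ERRATUM (v1.1, docstring only; referee ref-5 gen 28 ASK (a); p. 309 re-read as an IMAGE, `lit-balaban-ref-1/renders/cmp114/original-p053-x2.png`):
print reads *"… using the fact that V^{(k)}(Y) is a small polynomial in A^{(k)}, φ^{(k)}"* (NO tilde on `V^{(k)}(Y)`; `Ṽ^{(k)}` is only
the sum `Ṽ^{(k)}(Λ₁₂^{(k)}) = Σ_Y V^{(k)}(Y)` of (5.14.1)) and *"… easily beat the bounds A^{(k)}, φ^{(k)} ≦ cp(e_k)"* (`≦ cp(e_k)`, NOT the
`cp(te_k)` v1 quoted from the text layer).  Declarations are unchanged: the Lean radii `c_b·p(te_k)` are those of the p. 308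
interpolated restriction `χ_{Λ₁₂^{(k)},t}` ("defined as above replacing p(e_k) with p(te_k)"), not a quotation of this sentence.

WHAT THIS FILE ADDS (theorems only; no definitions, no `Prop` facts; axioms standard).
* §1 three elementary estimates: (a) *"the coefficient t in front of V(Y) … beat[s] the bounds A, φ ≦ cp(e_k)"*:
  **`t·(1 + C p(te_k))^m ≤ (1 + C(mp + |log e_k|)^p)^m` uniformly in `t ∈ (0,1]`** (`mul_one_add_pLog_pow_le`, from Mathlib
  `Real.abs_log_mul_self_rpow_lt`); (b) Gaussian fields have all polynomial moments (`integrable_one_add_sum_abs_pow`);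
  (c) `(1 + Cu)^M e^{−κu²} ≤ (1 + C)^M e^{M²/(4κ)}` (`one_add_mul_pow_mul_exp_neg_sq_le`).
* §2 the support of EVERY t-derivative of `χ′_{Λ,t}` lies in the field box `{∀ b, |Φ_b| ≤ c_b p(te_k)}`
  (`iteratedDeriv_prod_cutoff_t_eq_zero_of_not_mem_box`); on the box `t|W| ≤ KK′` (`mul_abs_le_of_mem_box`); hence the pointwise bounds
  on the Leibniz terms of `∂ⁿ_t[χ′_{Λ,t}e^{−tW}]`: `abs_leibnizTerm_le` (t-dependent polynomial factor, for the shell terms) and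
  `abs_momentTerm_le` (t-UNIFORM polynomial `e^{KK′}Kⁿ(1 + Σ|Φ_b|)^{mn}`, for the `i = 0` term — *"V(Y) cannot be replaced by its supremum"*).

PDF held: `paper:balaban1988-cmp114-bij-abelian-higgs-effective-action` (journal page = PDF page + 256); p. 309 [PDF 53].

CITATION HEADER (lean-in-tree rule).  Part of the lit-balaban TYPED SKELETON (HOME `run/shared/lean/pub/lit-balaban/`), Phase 2,
seat p36 (gen 8, unit `lit-balaban-p36`); rows **C2.Eq5.14.1-5.14.2** and **C2.Eq5.14.3-5.14.4** (p. 309 sentences) of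
`HOME/lit-balaban-r16/ROWS-C2-part2.md` (owner r16; typed leaves untouched).
-/

namespace Literature.MathematicalPhysics.QuantumFieldTheory.BalabanImbrieJaffe1984to88.BIJ88PolyInteractionBounds308

open MeasureTheory ProbabilityTheory Filter Set
open scoped Topology
open BIJ88Sect2Statements (pLog)
open BIJ88Sect5Statements (CutoffProfile cutoff)
open BIJ88PolyInteraction308 (prod_cutoff_t_eq_zero_of_not_mem_box)

/-! ## §1 Three elementary estimates -/

section Elementary

/-- **(a) *"the coefficient t in front of V(Y) … easily beat[s] the bounds A, φ ≦ cp(e_k)"*** (radii of `χ_{Λ,t}`: `c_b p(te_k)`, p. 308):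
for `p > 0`, `C ≥ 0`, `m ∈ ℕ` and every
`0 < t ≤ 1` with `te_k < 1`: `t·(1 + C·p(te_k))^m ≤ (1 + C·(mp + |log e_k|)^p)^m` — the t-uniform bound used on the support of `χ′_{Λ,t}`.
[cite: BalabanImbrieJaffe1988, p.309 (Sect. 5.14)] -/
theorem mul_one_add_pLog_pow_le {p : ℝ} (hp : 0 < p) {C : ℝ} (hC : 0 ≤ C) {ek : ℝ} (hek : 0 < ek) (m : ℕ) {t : ℝ}
    (ht : 0 < t) (ht1 : t ≤ 1) (h1 : t * ek < 1) :
    t * (1 + C * pLog p (t * ek)) ^ m ≤ (1 + C * ((m : ℝ) * p + |Real.log ek|) ^ p) ^ m := by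
  rcases Nat.eq_zero_or_pos m with hm | hm
  · subst hm; simpa using ht1
  have hm' : (0 : ℝ) < m := by exact_mod_cast hm
  set D : ℝ := (m : ℝ) * p + |Real.log ek| with hD
  have hD0 : 0 ≤ D := by positivity
  set r : ℝ := 1 / ((m : ℝ) * p) with hr
  have hmp : 0 < (m : ℝ) * p := by positivity
  have hr0 : 0 < r := by positivity
  have htr : 1 ≤ t ^ (-r) := Real.one_le_rpow_of_pos_of_le_one_of_nonpos ht ht1 (by linarith)
  -- |log t| ≤ (m p) t^{-r}
  have hlog : |Real.log t| ≤ (m : ℝ) * p * t ^ (-r) := by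
    have h := (Real.abs_log_mul_self_rpow_lt t r ht ht1 hr0).le
    rw [abs_mul, abs_of_pos (Real.rpow_pos_of_pos ht r)] at h
    have hmp' : 1 / r = (m : ℝ) * p := by rw [hr, one_div_one_div]
    rw [hmp'] at h
    rw [Real.rpow_neg ht.le, ← div_eq_mul_inv, le_div_iff₀ (Real.rpow_pos_of_pos ht r)]
    exact h
  -- −log(te_k) ≤ D t^{-r}
  have hneg : -Real.log (t * ek) ≤ D * t ^ (-r) := by
    rw [Real.log_mul ht.ne' hek.ne']
    have h2 : |Real.log ek| ≤ |Real.log ek| * t ^ (-r) := le_mul_of_one_le_right (abs_nonneg _) htr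
    have h3 : -Real.log t ≤ |Real.log t| := neg_le_abs _
    have h4 : -Real.log ek ≤ |Real.log ek| := neg_le_abs _
    calc -(Real.log t + Real.log ek) ≤ |Real.log t| + |Real.log ek| := by linarith
      _ ≤ (m : ℝ) * p * t ^ (-r) + |Real.log ek| * t ^ (-r) := add_le_add hlog h2
      _ = D * t ^ (-r) := by rw [hD]; ring
  -- p(te_k) ≤ D^p t^{-1/m}
  have hpl : pLog p (t * ek) ≤ D ^ p * t ^ (-(1 / (m : ℝ))) := by
    rw [BIJ88ChiTDeriv309.pLog_eq_rpow_neg_log p (mul_pos ht hek) h1]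
    have h0 : 0 ≤ -Real.log (t * ek) := by have := Real.log_neg (mul_pos ht hek) h1; linarith
    calc (-Real.log (t * ek)) ^ p ≤ (D * t ^ (-r)) ^ p := Real.rpow_le_rpow h0 hneg hp.le
      _ = D ^ p * (t ^ (-r)) ^ p := Real.mul_rpow hD0 (Real.rpow_nonneg ht.le _)
      _ = D ^ p * t ^ (-(1 / (m : ℝ))) := by
          rw [← Real.rpow_mul ht.le]
          congr 1
          rw [hr]
          field_simp
  have ht1m : 1 ≤ t ^ (-(1 / (m : ℝ))) :=
    Real.one_le_rpow_of_pos_of_le_one_of_nonpos ht ht1 (neg_nonpos.mpr (by positivity))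
  have hstep : 1 + C * pLog p (t * ek) ≤ (1 + C * D ^ p) * t ^ (-(1 / (m : ℝ))) := by
    calc 1 + C * pLog p (t * ek) ≤ 1 * t ^ (-(1 / (m : ℝ))) + C * (D ^ p * t ^ (-(1 / (m : ℝ)))) :=
          add_le_add (by simpa using ht1m) (mul_le_mul_of_nonneg_left hpl hC)
      _ = (1 + C * D ^ p) * t ^ (-(1 / (m : ℝ))) := by ring
  have hpow : (1 + C * pLog p (t * ek)) ^ m ≤ (1 + C * D ^ p) ^ m * t ^ (-(1 : ℝ)) := by
    have h0 : 0 ≤ 1 + C * pLog p (t * ek) := by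
      have := BIJ88RestrictionsVanish308.pLog_nonneg p (t * ek); positivity
    calc (1 + C * pLog p (t * ek)) ^ m ≤ ((1 + C * D ^ p) * t ^ (-(1 / (m : ℝ)))) ^ m := pow_le_pow_left₀ h0 hstep m
      _ = (1 + C * D ^ p) ^ m * (t ^ (-(1 / (m : ℝ)))) ^ m := mul_pow _ _ _
      _ = (1 + C * D ^ p) ^ m * t ^ (-(1 : ℝ)) := by
          congr 1
          rw [← Real.rpow_natCast, ← Real.rpow_mul ht.le]
          congr 1
          field_simp
  calc t * (1 + C * pLog p (t * ek)) ^ m ≤ t * ((1 + C * D ^ p) ^ m * t ^ (-(1 : ℝ))) :=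
        mul_le_mul_of_nonneg_left hpow ht.le
    _ = (1 + C * D ^ p) ^ m := by
        rw [Real.rpow_neg_one, mul_comm, mul_assoc, inv_mul_cancel₀ ht.ne', mul_one]

variable {ι Ω : Type*} [MeasurableSpace Ω]

/-- **(b) Gaussian fields have all polynomial moments**: `(1 + Σ_{b∈Λ}|Φ_b|)^N` is integrable for Gaussian marginals (Mathlib
`HasGaussianLaw.memLp`). [cite: BalabanImbrieJaffe1988, p.309 (Sect. 5.14)] -/
theorem integrable_one_add_sum_abs_pow (P : Measure Ω) [IsProbabilityMeasure P] (B : Finset ι) {Φ : ι → Ω → ℝ}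
    (hG : ∀ b ∈ B, HasGaussianLaw (Φ b) P) (N : ℕ) :
    Integrable (fun ω => (1 + ∑ b ∈ B, |Φ b ω|) ^ N) P := by
  by_cases hN : N = 0
  · rw [hN]
    simp only [pow_zero]
    exact integrable_const _
  have hN' : ((N : ℕ) : ENNReal) ≠ ⊤ := ENNReal.natCast_ne_top N
  have hmem : MemLp (fun ω => (1 : ℝ) + ∑ b ∈ B, |Φ b ω|) (N : ENNReal) P := by
    refine MemLp.add (memLp_const (1 : ℝ)) ?_
    refine memLp_finsetSum B fun b hb => ?_
    exact ((hG b hb).memLp hN').norm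
  have h := hmem.integrable_norm_pow hN
  refine h.congr (Filter.Eventually.of_forall fun ω => ?_)
  have h0 : 0 ≤ (1 : ℝ) + ∑ b ∈ B, |Φ b ω| := by positivity
  simp only [Real.norm_of_nonneg h0]

/-- **(c) a Gaussian shell factor beats any polynomial**: `(1 + Cu)^M·e^{−κu²} ≤ (1 + C)^M·e^{M²/(4κ)}` for `u ≥ 0`, `C ≥ 0`, `κ > 0`.
[cite: BalabanImbrieJaffe1988, p.309 (Sect. 5.14)] -/
theorem one_add_mul_pow_mul_exp_neg_sq_le {C κ : ℝ} (hC : 0 ≤ C) (hκ : 0 < κ) (M : ℕ) {u : ℝ} (hu : 0 ≤ u) :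
    (1 + C * u) ^ M * Real.exp (-(κ * u ^ 2)) ≤ (1 + C) ^ M * Real.exp ((M : ℝ) ^ 2 / (4 * κ)) := by
  have h1 : 1 + C * u ≤ (1 + C) * Real.exp u := by
    have he : u + 1 ≤ Real.exp u := Real.add_one_le_exp u
    have he1 : 1 ≤ Real.exp u := by linarith
    nlinarith [mul_le_mul_of_nonneg_left he hC]
  have h2 : (1 + C * u) ^ M ≤ (1 + C) ^ M * Real.exp ((M : ℝ) * u) := by
    calc (1 + C * u) ^ M ≤ ((1 + C) * Real.exp u) ^ M := pow_le_pow_left₀ (by positivity) h1 M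
      _ = (1 + C) ^ M * Real.exp ((M : ℝ) * u) := by rw [mul_pow, ← Real.exp_nat_mul]
  have h3 : Real.exp ((M : ℝ) * u) * Real.exp (-(κ * u ^ 2)) ≤ Real.exp ((M : ℝ) ^ 2 / (4 * κ)) := by
    rw [← Real.exp_add]
    refine Real.exp_le_exp.mpr ?_
    rw [le_div_iff₀ (by positivity : (0 : ℝ) < 4 * κ)]
    nlinarith [sq_nonneg (2 * κ * u - M)]
  calc (1 + C * u) ^ M * Real.exp (-(κ * u ^ 2)) ≤ (1 + C) ^ M * Real.exp ((M : ℝ) * u) * Real.exp (-(κ * u ^ 2)) :=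
        mul_le_mul_of_nonneg_right h2 (Real.exp_pos _).le
    _ = (1 + C) ^ M * (Real.exp ((M : ℝ) * u) * Real.exp (-(κ * u ^ 2))) := mul_assoc _ _ _
    _ ≤ (1 + C) ^ M * Real.exp ((M : ℝ) ^ 2 / (4 * κ)) := mul_le_mul_of_nonneg_left h3 (by positivity)

end Elementary

/-! ## §2 Every t-derivative of `χ′_{Λ,t}` is supported in the field box; `t|W| ≤ KK′` there -/

section SupportBox

variable (χ : CutoffProfile) {ι Ω : Type*} [MeasurableSpace Ω]

/-- **Every t-derivative of the restricted characteristic function is supported in the field box** `{∀ b ∈ Λ, |Φ_b| ≤ c_b p(te_k)}`: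
outside it the function `s ↦ χ′_{Λ,s}` vanishes identically on a neighbourhood of `t` (continuity of `s ↦ p(se_k)`), hence so does
every `iteratedDeriv` (any order, `i = 0` included). [cite: BalabanImbrieJaffe1988, p.309 (Sect. 5.14)] -/
theorem iteratedDeriv_prod_cutoff_t_eq_zero_of_not_mem_box {p : ℝ} (hp : 0 ≤ p) (B : Finset ι) (A c : ι → ℝ)
    (hc : ∀ b ∈ B, 0 < c b) {ek t : ℝ} (hek : 0 < ek) (ht : 0 < t) (h1 : t * ek < 1)
    (hA : ¬ ∀ b ∈ B, |A b| ≤ c b * pLog p (t * ek)) (i : ℕ) :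
    iteratedDeriv i (fun s => ∏ b ∈ B, cutoff χ (c b * pLog p (s * ek)) (A b)) t = 0 := by
  simp only [not_forall, not_le, exists_prop] at hA
  obtain ⟨b, hb, hlt⟩ := hA
  have hcont : ContinuousAt (fun s => c b * pLog p (s * ek)) t :=
    continuousAt_const.mul (BIJ88ChiTDeriv309.hasDerivAt_pLog_scale p ht hek h1).continuousAt
  have hev : ∀ᶠ s in 𝓝 t, c b * pLog p (s * ek) < |A b| := hcont.eventually_lt continuousAt_const hlt
  obtain ⟨a, ha, ha'⟩ := ((hev.filter_mono nhdsWithin_le_nhds).and (Ioo_mem_nhdsLT (by linarith : t / 2 < t))).exists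
  have hzero : (fun s => ∏ b ∈ B, cutoff χ (c b * pLog p (s * ek)) (A b)) =ᶠ[𝓝 t] fun _ => (0 : ℝ) := by
    have hmem : Set.Ioo a (1 / ek) ∈ 𝓝 t := isOpen_Ioo.mem_nhds ⟨ha'.2, by rw [lt_div_iff₀ hek]; exact h1⟩
    filter_upwards [hmem] with s hs
    have hs1 : s * ek < 1 := (lt_div_iff₀ hek).mp hs.2
    exact prod_cutoff_t_eq_zero_of_not_mem_box χ hp B A c hc hek (by linarith [ha'.1]) hs.1.le hs1
      (fun h => absurd (h b hb) (not_le.mpr ha))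
  rw [hzero.iteratedDeriv_eq i, iteratedDeriv_fun_const_zero]

omit [MeasurableSpace Ω] in
/-- Inside the field box the polynomially bounded interaction is at most `K(1 + (Σ_b c_b)·p(te_k))^m`.
[cite: BalabanImbrieJaffe1988, p.309 (Sect. 5.14)] -/
theorem abs_le_of_mem_box (p : ℝ) (B : Finset ι) (Φ : ι → Ω → ℝ) (c : ι → ℝ) {W : Ω → ℝ} {K : ℝ} (hK : 0 ≤ K) {m : ℕ}
    (hWg : ∀ ω, |W ω| ≤ K * (1 + ∑ b ∈ B, |Φ b ω|) ^ m) {ek t : ℝ} {ω : Ω} (hω : ∀ b ∈ B, |Φ b ω| ≤ c b * pLog p (t * ek)) :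
    |W ω| ≤ K * (1 + (∑ b ∈ B, c b) * pLog p (t * ek)) ^ m := by
  refine (hWg ω).trans (mul_le_mul_of_nonneg_left (pow_le_pow_left₀ (by positivity) ?_ _) hK)
  rw [Finset.sum_mul]
  linarith [Finset.sum_le_sum fun b hb => hω b hb]

omit [MeasurableSpace Ω] in
/-- **On the field box the coefficient `t` beats the interaction**: `t·|W(ω)| ≤ K·(1 + (Σ_b c_b)(mp + |log e_k|)^p)^m` for `0 < t ≤ 1`,
`te_k < 1`, `c_b > 0` (`p > 0`). [cite: BalabanImbrieJaffe1988, p.309 (Sect. 5.14)] -/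
theorem mul_abs_le_of_mem_box {p : ℝ} (hp : 0 < p) (B : Finset ι) (Φ : ι → Ω → ℝ) {c : ι → ℝ} (hc : ∀ b ∈ B, 0 < c b)
    {W : Ω → ℝ} {K : ℝ} (hK : 0 ≤ K) {m : ℕ} (hWg : ∀ ω, |W ω| ≤ K * (1 + ∑ b ∈ B, |Φ b ω|) ^ m) {ek t : ℝ} (hek : 0 < ek)
    (ht : 0 < t) (ht1 : t ≤ 1) (h1 : t * ek < 1) {ω : Ω} (hω : ∀ b ∈ B, |Φ b ω| ≤ c b * pLog p (t * ek)) :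
    t * |W ω| ≤ K * (1 + (∑ b ∈ B, c b) * ((m : ℝ) * p + |Real.log ek|) ^ p) ^ m := by
  have hC : 0 ≤ ∑ b ∈ B, c b := Finset.sum_nonneg fun b hb => (hc b hb).le
  calc t * |W ω| ≤ t * (K * (1 + (∑ b ∈ B, c b) * pLog p (t * ek)) ^ m) :=
        mul_le_mul_of_nonneg_left (abs_le_of_mem_box p B Φ c hK hWg hω) ht.le
    _ = K * (t * (1 + (∑ b ∈ B, c b) * pLog p (t * ek)) ^ m) := by ring
    _ ≤ K * (1 + (∑ b ∈ B, c b) * ((m : ℝ) * p + |Real.log ek|) ^ p) ^ m :=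
        mul_le_mul_of_nonneg_left (mul_one_add_pLog_pow_le hp hC hek m ht ht1 h1) hK

omit [MeasurableSpace Ω] in
/-- **The pointwise bound on every Leibniz term**: for `0 < t ≤ 1`, `te_k < 1`,
`|∂^i_tχ′_{Λ,t}(ω)·((−W(ω))ⁿe^{−tW(ω)})| ≤ e^{KK′}·(K(1 + (Σc_b)p(te_k))^m)ⁿ·|∂^i_tχ′_{Λ,t}(ω)|` (off the field box both sides vanish).
[cite: BalabanImbrieJaffe1988, p.309 (Sect. 5.14)] -/
theorem abs_leibnizTerm_le {p : ℝ} (hp : 0 < p) (B : Finset ι) (Φ : ι → Ω → ℝ) {c : ι → ℝ} (hc : ∀ b ∈ B, 0 < c b)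
    {W : Ω → ℝ} {K : ℝ} (hK : 0 ≤ K) {m : ℕ} (hWg : ∀ ω, |W ω| ≤ K * (1 + ∑ b ∈ B, |Φ b ω|) ^ m) {ek t : ℝ} (hek : 0 < ek)
    (ht : 0 < t) (ht1 : t ≤ 1) (h1 : t * ek < 1) (i n : ℕ) (ω : Ω) :
    |iteratedDeriv i (fun s => ∏ b ∈ B, cutoff χ (c b * pLog p (s * ek)) (Φ b ω)) t * ((-W ω) ^ n * Real.exp (-(t * W ω)))| ≤
      Real.exp (K * (1 + (∑ b ∈ B, c b) * ((m : ℝ) * p + |Real.log ek|) ^ p) ^ m) *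
        (K * (1 + (∑ b ∈ B, c b) * pLog p (t * ek)) ^ m) ^ n *
          |iteratedDeriv i (fun s => ∏ b ∈ B, cutoff χ (c b * pLog p (s * ek)) (Φ b ω)) t| := by
  by_cases hω : ∀ b ∈ B, |Φ b ω| ≤ c b * pLog p (t * ek)
  · rw [abs_mul, abs_mul, Real.abs_exp, abs_pow, abs_neg, mul_comm]
    refine mul_le_mul_of_nonneg_right ?_ (abs_nonneg _)
    rw [mul_comm]
    refine mul_le_mul (Real.exp_le_exp.mpr ?_) (pow_le_pow_left₀ (abs_nonneg _) (abs_le_of_mem_box p B Φ c hK hWg hω) _)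
      (pow_nonneg (abs_nonneg _) _) (Real.exp_pos _).le
    have h := mul_abs_le_of_mem_box hp B Φ hc hK hWg hek ht ht1 h1 hω
    have h' : -(t * W ω) ≤ t * |W ω| := by
      rw [← mul_neg]; exact mul_le_mul_of_nonneg_left (neg_le_abs _) ht.le
    linarith
  · rw [iteratedDeriv_prod_cutoff_t_eq_zero_of_not_mem_box χ hp.le B (fun b => Φ b ω) c hc hek ht h1 hω i]
    simp

omit [MeasurableSpace Ω] in
/-- The t-uniform bound for the `i = 0` term: `|χ′_{Λ,t}(−W)ⁿe^{−tW}| ≤ e^{KK′}·Kⁿ(1 + Σ_b|Φ_b|)^{mn}` — *"V(Y) cannot be replaced by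
its supremum"*: the moment factor stays a polynomial in the fields, only `e^{−tV}` is bounded on the support.
[cite: BalabanImbrieJaffe1988, p.309 (Sect. 5.14)] -/
theorem abs_momentTerm_le {p : ℝ} (hp : 0 < p) (B : Finset ι) (Φ : ι → Ω → ℝ) {c : ι → ℝ} (hc : ∀ b ∈ B, 0 < c b)
    {W : Ω → ℝ} {K : ℝ} (hK : 0 ≤ K) {m : ℕ} (hWg : ∀ ω, |W ω| ≤ K * (1 + ∑ b ∈ B, |Φ b ω|) ^ m) {ek t : ℝ} (hek : 0 < ek)
    (ht : 0 < t) (ht1 : t ≤ 1) (h1 : t * ek < 1) (n : ℕ) (ω : Ω) :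
    |(∏ b ∈ B, cutoff χ (c b * pLog p (t * ek)) (Φ b ω)) * ((-W ω) ^ n * Real.exp (-(t * W ω)))| ≤
      Real.exp (K * (1 + (∑ b ∈ B, c b) * ((m : ℝ) * p + |Real.log ek|) ^ p) ^ m) *
        (K ^ n * (1 + ∑ b ∈ B, |Φ b ω|) ^ (m * n)) := by
  have hKn : |(-W ω) ^ n| ≤ K ^ n * (1 + ∑ b ∈ B, |Φ b ω|) ^ (m * n) := by
    rw [abs_pow, abs_neg, pow_mul, ← mul_pow]
    exact pow_le_pow_left₀ (abs_nonneg _) (hWg ω) _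
  by_cases hω : ∀ b ∈ B, |Φ b ω| ≤ c b * pLog p (t * ek)
  · rw [abs_mul, abs_mul, Real.abs_exp]
    have hχ1 := BIJ88InterpolatedRestrictions308.abs_prod_cutoff_t_le_one χ p B (fun b => Φ b ω) c ek t
    have hexp : Real.exp (-(t * W ω)) ≤ Real.exp (K * (1 + (∑ b ∈ B, c b) * ((m : ℝ) * p + |Real.log ek|) ^ p) ^ m) := by
      refine Real.exp_le_exp.mpr ?_
      have h := mul_abs_le_of_mem_box hp B Φ hc hK hWg hek ht ht1 h1 hω
      have h' : -(t * W ω) ≤ t * |W ω| := by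
        rw [← mul_neg]; exact mul_le_mul_of_nonneg_left (neg_le_abs _) ht.le
      linarith
    calc |∏ b ∈ B, cutoff χ (c b * pLog p (t * ek)) (Φ b ω)| * (|(-W ω) ^ n| * Real.exp (-(t * W ω)))
        ≤ 1 * ((K ^ n * (1 + ∑ b ∈ B, |Φ b ω|) ^ (m * n)) *
            Real.exp (K * (1 + (∑ b ∈ B, c b) * ((m : ℝ) * p + |Real.log ek|) ^ p) ^ m)) :=
          mul_le_mul hχ1 (mul_le_mul hKn hexp (Real.exp_pos _).le (by positivity)) (by positivity) zero_le_one
      _ = _ := by ring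
  · have h0 := prod_cutoff_t_eq_zero_of_not_mem_box χ hp.le B (fun b => Φ b ω) c hc hek ht le_rfl h1 hω
    rw [h0, zero_mul, abs_zero]
    positivity

end SupportBox

end Literature.MathematicalPhysics.QuantumFieldTheory.BalabanImbrieJaffe1984to88.BIJ88PolyInteractionBounds308
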